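import Literature.NumberTheory.Transcendental.ComplexFormsProofs
import Literature.Geometry.Kaehler.ManifoldFormsChart
import Literature.Geometry.Kaehler.KaehlerProofs
import HarnessLib

/-!
# Smoothness of the type components of a complex form on a complex manifold — proofs

Trunk **T-KAEHLER** (`NumberTheory/Transcendental`). Theorems-only companion of
`Literature/NumberTheory/Transcendental/ComplexForms.lean`, discharging the three named facts of
its section *Statements needing a holomorphic atlas* that concern smoothness:

| named fact of `ComplexForms.lean`                                         | discharged by                              |
|---------------------------------------------------------------------------|--------------------------------------------|
| `Literature.NumberTheory.Transcendental.isSmoothForm_weightComponent`    | `isSmoothForm_weightComponent_holds`       |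
| `Literature.NumberTheory.Transcendental.isSmoothForm_typeComponent`      | `isSmoothForm_typeComponent_holds`         |
| `Literature.NumberTheory.Transcendental.typeComponent_mem_pqForms`       | `typeComponent_mem_pqForms_holds`          |
| `Literature.NumberTheory.Transcendental.cexactSmoothForms_le_cclosedSmoothForms` (appended, v2) | `cexactSmoothForms_le_cclosedSmoothForms_holds` |

On a complex manifold `M` (charts valued in the complex normed space `E`, holomorphic transition
maps) the `(p,q)`-component `α^{p,q}` of a smooth complex `k`-form `α` is smooth (Voisin (2002),
§2.3.1: the decomposition `Ω^k_{X,ℂ} = ⊕ Ω^{p,q}_X` is a decomposition of `C^∞` vector bundles,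
the operator `I` being globally defined because "the change of chart morphisms are holomorphic,
i.e. have `ℂ`-linear differentials", §2.2.1, p. 44).

## The holomorphic-atlas hypothesis

`ComplexForms.lean` states these three facts inside a section with the instances
`[IsManifold 𝓘(ℂ, E) ω M] [IsManifold 𝓘(ℝ, E) ∞ M]`, and its module docstring explains why they
are needed ("`inChart` conjugates by derivatives of transition maps, which commute with
`tangentRotate` only when they are `ℂ`-linear").  A `def … : Prop` does not pick up unused
section instances, however, so the three `Prop`s themselves carry no atlas hypothesis (and are
not provable for a general charted space, where `typeComponent` is chart-dependent).  The
discharges below therefore take the two instances as instance arguments — exactly the hypotheses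
documented at the facts and available at every consumer (`Dolbeault.lean`, `KaehlerHodge.lean`,
`DeRhamComparison*.lean` thread `hst : ∀ {k}, isSmoothForm_typeComponent` under these instances).

## Proof

For fixed `θ` let `R = e^{iθ}·` on `E` and `β x = α x ∘ R` (the form `α` evaluated on rotated
vectors; `tangentRotate E x θ = R` in every tangent space; no new definition is introduced, the
rotated form is written `fun x ↦ (α x).compContinuousLinearMap (tangentRotate E x θ)`).  In the
chart at `x₀`, at a point `y` of the chart target over `z`, both representatives are conjugates by the tangent coordinate change
`T = tangentCoordChange 𝓘(ℝ, E) x₀ z z` (`MForm.inChart_eq_of_mem_target`):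
`α.inChart x₀ y = α z ∘ T`, `β.inChart x₀ y = α z ∘ R ∘ T`.  On a complex manifold `T` is the
restriction of scalars of the complex coordinate change (`tangentCoordChange_eq_restrictScalars`),
hence commutes with `R`, so `β.inChart x₀ = (α.inChart x₀) ∘ R` on the whole chart target
(`inChart_compContinuousLinearMap_tangentRotate_eq`), which is `C^∞` at the centre as the
pull-back of a `C^∞` family of alternating maps along a constant linear map
(`ContDiffWithinAt.continuousAlternatingMapCompContinuousLinearMap`).  The weight components are
finite linear combinations (complex coefficients) of such `β`'s, and `α^{p,q}` is a weight
component or `0`.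

## Appended (v2): exact complex forms are closed

The fourth row is the one fact of the section *Smoothness over `ℂ`: the complex de Rham complex*
of `ComplexForms.lean` that needs the chart calculus of `d`: `B^k(M; ℂ) ⊆ Z^k(M; ℂ)`, i.e.
`d ∘ d = 0` and smoothness of `dα` on a `C^∞` manifold (Bott–Tu (1982), §I.1: `d² = 0`, the
closed forms are the kernel of `d` and the exact forms its image, `H^q_{DR} = {closed}/{exact}`;
Lee (2012), Thm. 14.24(iii) `d ∘ d ≡ 0` on a smooth manifold, and Ch. 17: "every exact form is
closed implies `B^p(M) ⊆ Z^p(M)`"). It is discharged from G21's `isSmoothForm_mextDeriv` /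
`mextDeriv_mextDeriv`
(`Geometry/Kaehler/ManifoldForms`), whose chart-independence hypothesis `inChart_mextDeriv` is the
theorem `inChart_mextDeriv_holds` of `Geometry/Kaehler/ManifoldFormsChart` (already imported here);
no holomorphic atlas is involved (only `[IsManifold 𝓘(ℝ, E) ∞ M]`, bound inside the fact).

## References

* C. Voisin, *Hodge Theory and Complex Algebraic Geometry I* (2002), §2.2.1 (p. 44), §2.3.1
  (pp. 53–54). [Voisin2002]
* R. O. Wells, *Differential Analysis on Complex Manifolds* (1980), Ch. I §3.
* R. Bott, L. W. Tu, *Differential Forms in Algebraic Topology*, GTM 82 (1982), §I.1 (the de Rham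
  complex, `d² = 0`, closed and exact forms). [BottTu1982Forms] (stub key `BottTu1982` at the fact)
* J. M. Lee, *Introduction to Smooth Manifolds*, 2nd ed., GTM 218 (2012), Thm. 14.24 and Ch. 17
  (`Z^p(M)`, `B^p(M)`, `H^p_dR(M)`). [Lee2012]
-/

noncomputable section

open scoped Manifold ContDiff Topology
open Bundle Set Finset

namespace Literature.NumberTheory.Transcendental

variable {E : Type*} [NormedAddCommGroup E] [NormedSpace ℂ E]
  {M : Type*} [TopologicalSpace M] [ChartedSpace E M] {k : ℕ}

/-! ### Rotated forms -/

/-- The weight-`w` component is a finite linear combination (complex coefficients) of the forms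
`x ↦ α x ∘ e^{iθⱼ}` (`α` evaluated on rotated vectors) — its definition, as an identity of forms.
[folklore] -/
theorem _root_.Literature.Geometry.Kaehler.MForm.weightComponent_eq_sum_compContinuousLinearMap
    (w : ℤ) (α : Literature.Geometry.Kaehler.MForm 𝓘(ℝ, E) M ℂ k) :
    α.weightComponent w = ((2 * k + 1 : ℕ) : ℂ)⁻¹ • ∑ j : Fin (2 * k + 1),
      Complex.exp (-(w * (2 * Real.pi * j / (2 * k + 1)) : ℝ) * Complex.I) •
        (fun x ↦ (α x).compContinuousLinearMap (tangentRotate E x (2 * Real.pi * j / (2 * k + 1))) :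
          Literature.Geometry.Kaehler.MForm 𝓘(ℝ, E) M ℂ k) := by
  funext x
  simp only [Literature.Geometry.Kaehler.MForm.weightComponent, Pi.smul_apply, Finset.sum_apply]

section Holomorphic

variable [IsManifold 𝓘(ℂ, E) ω M] [IsManifold 𝓘(ℝ, E) ∞ M]

/-- **Holomorphic coordinate changes commute with `e^{iθ}`.** On a complex manifold the tangent
coordinate change of the real tangent bundle at a point `z` of the chart domain of `x₀` is
`ℂ`-linear (`tangentCoordChange_eq_restrictScalars`), hence commutes with the rotation
`tangentRotate`. Voisin (2002), §2.2.1, p. 44. [cite: Voisin2002, §2.2.1] -/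
theorem tangentCoordChange_tangentRotate {x₀ z : M} (hz : z ∈ (extChartAt 𝓘(ℝ, E) x₀).source)
    (θ : ℝ) (u : E) :
    tangentCoordChange 𝓘(ℝ, E) x₀ z z (tangentRotate E z θ u) =
      tangentRotate E z θ (tangentCoordChange 𝓘(ℝ, E) x₀ z z u) := by
  have hz' : z ∈ (extChartAt 𝓘(ℂ, E) x₀).source ∩ (extChartAt 𝓘(ℂ, E) z).source := by
    simp only [extChartAt_source] at hz ⊢
    exact ⟨hz, mem_chart_source E z⟩
  rw [Literature.Geometry.Kaehler.tangentCoordChange_eq_restrictScalars hz', tangentRotate_apply,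
    tangentRotate_apply, ContinuousLinearMap.coe_restrictScalars']
  exact (tangentCoordChange 𝓘(ℂ, E) x₀ z z).map_smul _ u

/-- **Chart representative of a rotated form.** On the whole target of the chart at `x₀`, the
representative of `x ↦ α x ∘ e^{iθ}` is the representative of `α` composed with the (constant)
rotation `e^{iθ}` of the model space: the derivative of the inverse chart is a tangent coordinate
change (`MForm.inChart_eq_of_mem_target`), which commutes with `e^{iθ}`
(`tangentCoordChange_tangentRotate`). [cite: Voisin2002, §2.3.1] -/
theorem inChart_compContinuousLinearMap_tangentRotate_eq (θ : ℝ)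
    (α : Literature.Geometry.Kaehler.MForm 𝓘(ℝ, E) M ℂ k)
    {x₀ : M} {y : E} (hy : y ∈ (extChartAt 𝓘(ℝ, E) x₀).target) :
    Literature.Geometry.Kaehler.MForm.inChart
        (fun x ↦ (α x).compContinuousLinearMap (tangentRotate E x θ) :
          Literature.Geometry.Kaehler.MForm 𝓘(ℝ, E) M ℂ k) x₀ y =
      (α.inChart x₀ y).compContinuousLinearMap
        ((Complex.exp (θ * Complex.I) • ContinuousLinearMap.id ℂ E).restrictScalars ℝ) := by
  have hz : (extChartAt 𝓘(ℝ, E) x₀).symm y ∈ (extChartAt 𝓘(ℝ, E) x₀).source :=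
    (extChartAt 𝓘(ℝ, E) x₀).map_target hy
  rw [Literature.Geometry.Kaehler.MForm.inChart_eq_of_mem_target _ hy, α.inChart_eq_of_mem_target hy]
  ext v
  simp only [ContinuousAlternatingMap.compContinuousLinearMap_apply]
  congr 1
  funext i
  exact (tangentCoordChange_tangentRotate hz θ (v i)).symm

/-- **A smooth form evaluated on rotated vectors is smooth** (complex manifold): by
`inChart_compContinuousLinearMap_tangentRotate_eq` its chart representative is, near the centre,
the pull-back of the `C^∞` representative of `α` along a constant linear map. Voisin (2002),
§2.3.1. [cite: Voisin2002, §2.3.1] -/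
theorem _root_.Literature.Geometry.Kaehler.IsSmoothForm.compContinuousLinearMap_tangentRotate
    (θ : ℝ) {α : Literature.Geometry.Kaehler.MForm 𝓘(ℝ, E) M ℂ k}
    (hα : Literature.Geometry.Kaehler.IsSmoothForm α) :
    Literature.Geometry.Kaehler.IsSmoothForm
      (fun x ↦ (α x).compContinuousLinearMap (tangentRotate E x θ) :
        Literature.Geometry.Kaehler.MForm 𝓘(ℝ, E) M ℂ k) := by
  intro x₀
  set R : E →L[ℝ] E :=
    (Complex.exp (θ * Complex.I) • ContinuousLinearMap.id ℂ E).restrictScalars ℝ with hR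
  have hev : Literature.Geometry.Kaehler.MForm.inChart
      (fun x ↦ (α x).compContinuousLinearMap (tangentRotate E x θ) :
        Literature.Geometry.Kaehler.MForm 𝓘(ℝ, E) M ℂ k) x₀ =ᶠ[𝓝[range 𝓘(ℝ, E)] (extChartAt 𝓘(ℝ, E) x₀ x₀)]
      fun y ↦ (α.inChart x₀ y).compContinuousLinearMap R := by
    filter_upwards [extChartAt_target_mem_nhdsWithin (I := 𝓘(ℝ, E)) x₀] with y hy
    exact inChart_compContinuousLinearMap_tangentRotate_eq θ α hy
  have hs : ContDiffWithinAt ℝ ∞ (fun y ↦ (α.inChart x₀ y).compContinuousLinearMap R)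
      (range 𝓘(ℝ, E)) (extChartAt 𝓘(ℝ, E) x₀ x₀) :=
    ContDiffWithinAt.continuousAlternatingMapCompContinuousLinearMap (hα x₀) contDiffWithinAt_const
  exact hs.congr_of_eventuallyEq hev
    (hev.self_of_nhdsWithin (extChartAt_target_subset_range x₀ (mem_extChartAt_target x₀)))

/-- **Weight components of a smooth form are smooth** on a complex manifold (a finite linear
combination, with complex coefficients, of smooth rotated forms). Voisin (2002), §2.3.1.
[cite: Voisin2002, §2.3.1] -/
theorem _root_.Literature.Geometry.Kaehler.IsSmoothForm.weightComponent (w : ℤ)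
    {α : Literature.Geometry.Kaehler.MForm 𝓘(ℝ, E) M ℂ k}
    (hα : Literature.Geometry.Kaehler.IsSmoothForm α) :
    Literature.Geometry.Kaehler.IsSmoothForm (α.weightComponent w) := by
  rw [α.weightComponent_eq_sum_compContinuousLinearMap w]
  refine Literature.Geometry.Kaehler.IsSmoothForm.smul_complex _ ?_
  exact (Literature.Geometry.Kaehler.smoothForms 𝓘(ℝ, E) M ℂ k).sum_mem fun j _ ↦
    Literature.Geometry.Kaehler.IsSmoothForm.smul_complex _
      (hα.compContinuousLinearMap_tangentRotate _)

/-- **Type components of a smooth form are smooth** on a complex manifold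
(`α^{p,q}` is a weight component, or `0`). Voisin (2002), §2.3.1; Wells (1980), Ch. I §3.
[cite: Voisin2002, §2.3.1] -/
theorem _root_.Literature.Geometry.Kaehler.IsSmoothForm.typeComponent (p q : ℕ)
    {α : Literature.Geometry.Kaehler.MForm 𝓘(ℝ, E) M ℂ k}
    (hα : Literature.Geometry.Kaehler.IsSmoothForm α) :
    Literature.Geometry.Kaehler.IsSmoothForm (α.typeComponent p q) := by
  unfold Literature.Geometry.Kaehler.MForm.typeComponent
  split_ifs
  · exact hα.weightComponent _
  · exact Literature.Geometry.Kaehler.isSmoothForm_zero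

/-- Discharge of the named fact `Literature.NumberTheory.Transcendental.isSmoothForm_weightComponent`
(on a complex manifold the weight components of a smooth form are smooth; Voisin (2002), §2.3.1),
under the holomorphic-atlas instances documented at the fact. [cite: Voisin2002, §2.3.1] -/
theorem isSmoothForm_weightComponent_holds :
    isSmoothForm_weightComponent (E := E) (M := M) (k := k) :=
  fun w _ hα ↦ hα.weightComponent w

/-- Discharge of the named fact `Literature.NumberTheory.Transcendental.isSmoothForm_typeComponent`
(on a complex manifold the type components of a smooth form are smooth; Voisin (2002), §2.3.1),
under the holomorphic-atlas instances documented at the fact. [cite: Voisin2002, §2.3.1] -/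
theorem isSmoothForm_typeComponent_holds :
    isSmoothForm_typeComponent (E := E) (M := M) (k := k) :=
  fun p q _ hα ↦ hα.typeComponent p q

/-- Discharge of the named fact `Literature.NumberTheory.Transcendental.typeComponent_mem_pqForms`:
on a complex manifold the `(p,q)`-component of a smooth `(p+q)`-form lies in `A^{p,q}(M)`
(smooth by `isSmoothForm_typeComponent_holds`, of type `(p,q)` by the discharged
`isOfType_typeComponent_holds`; this is the interim proof preserved in `ComplexForms.lean`).
Voisin (2002), §2.3.1. [cite: Voisin2002, §2.3.1] -/
theorem typeComponent_mem_pqForms_holds :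
    typeComponent_mem_pqForms (E := E) (M := M) :=
  fun {p q _} hα ↦ (mem_pqForms_iff _).mpr
    ⟨isSmoothForm_typeComponent_holds p q hα, isOfType_typeComponent_holds rfl _⟩

end Holomorphic

/-! ### Appended (v2): exact complex forms are closed (`d ∘ d = 0`)

Discharge of the named fact `Literature.NumberTheory.Transcendental.cexactSmoothForms_le_cclosedSmoothForms`
of `ComplexForms.lean`: on a `C^∞` manifold, `B^k(M; ℂ) ≤ Z^k(M; ℂ)`. The `ℂ`-span
`cexactSmoothForms E M (k + 1)` is generated by the `dα`, `α` a smooth complex `k`-form, and each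
generator is smooth (`isSmoothForm_mextDeriv`) and closed (`mextDeriv_mextDeriv`, `d (dα) = 0`),
both from G21's `ManifoldForms` under the chart-independence fact `inChart_mextDeriv`, which is the
theorem `inChart_mextDeriv_holds` (`ManifoldFormsChart`); degree `0` is `B⁰ = 0`. Bott–Tu (1982),
§I.1 (`d² = 0`; the closed forms `= ker d` contain the exact forms `= im d`); Lee (2012),
Thm. 14.24(iii) and Ch. 17 (`B^p(M) ⊆ Z^p(M)`). -/

section ExactClosed

/-- **`dα` is a closed smooth complex form** for every smooth complex `k`-form `α` on a `C^∞`
manifold: `dα` is smooth (`isSmoothForm_mextDeriv`) and `d (dα) = 0` (`mextDeriv_mextDeriv`), the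
chart-independence hypothesis of both being `inChart_mextDeriv_holds`. Bott–Tu (1982), §I.1
(`d² = 0`); Lee (2012), Thm. 14.24(iii) (`d ∘ d ≡ 0` on a smooth manifold).
[cite: BottTu1982Forms, §I.1] [cite: Lee2012, Thm. 14.24(iii)] -/
theorem mextDeriv_mem_cclosedSmoothForms [IsManifold 𝓘(ℝ, E) ∞ M]
    {α : Literature.Geometry.Kaehler.MForm 𝓘(ℝ, E) M ℂ k}
    (hα : Literature.Geometry.Kaehler.IsSmoothForm α) :
    Literature.Geometry.Kaehler.mextDeriv α ∈ cclosedSmoothForms E M (k + 1) :=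
  have h : Literature.Geometry.Kaehler.inChart_mextDeriv 𝓘(ℝ, E) M ℂ :=
    Literature.Geometry.Kaehler.inChart_mextDeriv_holds 𝓘(ℝ, E) M ℂ
  mem_cclosedSmoothForms (Literature.Geometry.Kaehler.isSmoothForm_mextDeriv h hα)
    (Literature.Geometry.Kaehler.mextDeriv_mextDeriv h hα)

/-- Discharge of the named fact
`Literature.NumberTheory.Transcendental.cexactSmoothForms_le_cclosedSmoothForms`: **exact smooth
complex forms are closed**, `B^k(M; ℂ) ≤ Z^k(M; ℂ)` on a `C^∞` manifold — `B⁰ = 0`, and in degree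
`k + 1` the generators `dα` (`α` smooth) of the `ℂ`-span `B^{k+1}(M; ℂ)` lie in the submodule
`Z^{k+1}(M; ℂ)` by `mextDeriv_mem_cclosedSmoothForms` (`d ∘ d = 0`), hence so does their span
(`Submodule.span_le`). Bott–Tu (1982), §I.1: `d² = 0`, so the exact forms (the image of `d`) are
among the closed forms (the kernel of `d`) and `H^q_{DR} = {closed q-forms}/{exact q-forms}` is
defined; Lee (2012), Ch. 17: "the fact that every exact form is closed implies
`B^p(M) ⊆ Z^p(M)`", with `d ∘ d ≡ 0` from Thm. 14.24(iii).
[cite: BottTu1982Forms, §I.1] [cite: Lee2012, Ch. 17] -/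
theorem cexactSmoothForms_le_cclosedSmoothForms_holds :
    cexactSmoothForms_le_cclosedSmoothForms (E := E) (M := M) (k := k) := by
  intro _
  cases k with
  | zero => exact bot_le
  | succ k =>
    refine Submodule.span_le.2 ?_
    rintro _ ⟨α, hα, rfl⟩
    exact mextDeriv_mem_cclosedSmoothForms ((mem_csmoothForms_iff α).1 hα)

end ExactClosed

end Literature.NumberTheory.Transcendental
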